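import Summits.ValiantsHypothesis.ValiantsHypothesis.Theorems.MonotoneRestorationOrbitRestorationQPTermBlocksPairedVandermondes
import Summits.ValiantsHypothesis.ValiantsHypothesis.Theorems.MonotoneRestorationOrbitRestorationQPExplicitToPDClass
import HarnessLib

/-!
# `e₂` of the column Vandermondes lies in the hypothesis class of `A_∞` — a certified instance of the rung

Route MonotoneRestoration, crux `OrbitRestorationQP` (stmt-ValiantsHypothesis-18293), line `depth-three-rung`, rung
`A_∞ = stub_sigmaPiSigmaValue`; namespace `Summit.ValiantsHypothesis.ValiantsHypothesis.Theorems.TermBlocks`.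

`…TermBlocksPairedVandermondes.lean` restores the family `P_n = Σ_{{j,j'}} D_j D_{j'}` (`D_j = Π_{i<i'} (x_{ij} − x_{i'j})`)
with the uniform constant `9` and proves it matrix-symmetric.  Here the remaining hypothesis of the registered stub
`stub_sigmaPiSigmaValue` is certified: `P_n` is given by EXPLICIT depth-three data — `n²` index pairs `(j, j')`, coefficient
`1` if `j < j'` and `0` otherwise, factor multiset the `n(n−1)` forms `x_{ij} − x_{i'j}`, `x_{ij'} − x_{i'j'}` (`i < i'`) — so
`ExplicitForm.pdClass_one_of_explicit` (Gupta–Kamath–Kayal–Saptharishi normal form ⇒ `ArithCircuit` of product depth `1`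
with polynomially many wires, landed) puts it in `PDClass (fun _ => 1) n c₁` for one absolute `c₁`.  Hence
`sigmaPiSigmaValue_holds_e2_columnVandermondes`: the family satisfies the hypothesis AND the conclusion of `A_∞` — an
instance of the open stub settled by a mechanism (pairing of sign-twisted factors across the columns of a term, file
`…TermBlocks.lean`) that none of the landed groupable kinds (T)/(S)/(B)/(K) or strata (`ℂ[r,c]`, wreath, Waring, symmetric
model) provides.

* `sum_powersetCard_two` — `Σ_{A ∈ 2-subsets} g A = Σ_i Σ_{i' > i} g {i, i'}`;
* `pdClass_e2_columnVandermondes` — `P_n ∈ PDClass (fun _ => 1) n (2 (2·3+8) + 3^(2·3+8))` for every `n`;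
* `sigmaPiSigmaValue_holds_e2_columnVandermondes` — matrix symmetry ∧ `PDClass 1` membership ∧ uniform restorability.

Honest label: bookkeeping that makes the witness an honest instance of the stub; the stub, the crux and VP ≠ VNP are not
moved.  Everything is proved. [folklore]

## References
* A. Gupta, P. Kamath, N. Kayal, R. Saptharishi, *Arithmetic circuits: a chasm at depth 3*, SIAM J. Comput. 45 (2016), §1
  eq. (1). [GuptaKamathKayalSaptharishi2016]
* A. Dawar, G. Wilsenach, *Symmetric arithmetic circuits*, ToC 21 (2025), §3.3. [DawarWilsenach2025]
-/

noncomputable section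

open scoped Classical Pointwise

-- `Summit.ValiantsHypothesis.ValiantsHypothesis.…` is the tree's single-conjunct layout (Sub = Summit).
set_option linter.dupNamespace false

namespace Summit.ValiantsHypothesis.ValiantsHypothesis.Theorems

namespace TermBlocks

open MvPolynomial Equiv Finset Literature.Computability.AlgebraicComplexity OrbitRestorationQPDepthThreeRung

variable {n : ℕ}

/-- **Sums over 2-subsets are sums over ordered pairs `i < i'`.** [folklore] -/
theorem sum_powersetCard_two {R : Type*} [AddCommMonoid R] (g : Finset (Fin n) → R) :
    ∑ A ∈ (univ : Finset (Fin n)).powersetCard 2, g A = ∑ i : Fin n, ∑ i' ∈ Ioi i, g {i, i'} := by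
  have h := prod_powersetCard_two (R := Multiplicative R) (fun A => Multiplicative.ofAdd (g A))
  simpa using congrArg Multiplicative.toAdd h

/-- **`P_n = e₂(D_1, …, D_n)` LIES IN THE `ΣΠΣ` SLICE `PDClass 1`**, with an absolute constant: it is the explicit
depth-three datum with `n²` terms (pairs of columns, coefficient `[j < j']`) of `n(n−1)` affine factors each.
[cite: GuptaKamathKayalSaptharishi2016, §1 eq. (1)] -/
theorem pdClass_e2_columnVandermondes (n : ℕ) :
    PDClass (fun _ => 1) n (2 * (2 * 3 + 8) + 3 ^ (2 * 3 + 8))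
      (∑ T ∈ (univ : Finset (Fin n)).powersetCard 2,
        ∏ j ∈ T, ∏ i : Fin n, ∏ i' ∈ Ioi i, (X (i, j) - X (i', j) : MvPolynomial (Fin n × Fin n) ℂ)) := by
  -- the explicit data
  set r : Finset (Fin n × Fin n) := univ.filter fun q => q.1 < q.2 with hr
  set V : Fin n → Multiset (MvPolynomial (Fin n × Fin n) ℂ) :=
    fun j => r.val.map fun q => X (q.1, j) - X (q.2, j) with hV
  set L : Fin n × Fin n → Multiset (MvPolynomial (Fin n × Fin n) ℂ) := fun p => V p.1 + V p.2 with hL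
  set a : Fin n × Fin n → ℂ := fun p => if p.1 < p.2 then 1 else 0 with ha
  have hmem : ∀ q : Fin n × Fin n, q ∈ r ↔ q.1 ∈ (univ : Finset (Fin n)) ∧ q.2 ∈ Ioi q.1 := fun q => by
    simp only [hr, mem_filter, mem_univ, true_and, mem_Ioi]
  -- the column Vandermonde as the product of `V j`
  have hVprod : ∀ j : Fin n, (V j).prod = ∏ i : Fin n, ∏ i' ∈ Ioi i, (X (i, j) - X (i', j)) := by
    intro j
    rw [hV, ← prod_eq_multiset_prod]
    exact prod_finset_product' r univ (fun i => Ioi i) hmem (f := fun i i' => X (i, j) - X (i', j))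
  -- size bounds
  have hn3 : n * n ≤ n ^ 3 + 3 := by
    rcases Nat.eq_zero_or_pos n with rfl | hn
    · simp
    · calc n * n ≤ n * n * n := Nat.le_mul_of_pos_right _ hn
        _ = n ^ 3 := by ring
        _ ≤ n ^ 3 + 3 := Nat.le_add_right _ _
  have hrcard : r.card ≤ n * n := by
    calc r.card ≤ (univ : Finset (Fin n × Fin n)).card := card_le_card (filter_subset _ _)
      _ = n * n := by rw [card_univ, Fintype.card_prod, Fintype.card_fin]
  have hVcard : ∀ j, Multiset.card (V j) ≤ n * n := fun j => by
    rw [hV, Multiset.card_map, card_val]; exact hrcard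
  have hT : Fintype.card (Fin n × Fin n) ≤ n ^ 3 + 3 := by
    rw [Fintype.card_prod, Fintype.card_fin]; exact hn3
  have hdeg : ∀ p, ∀ ℓ ∈ L p, ℓ.totalDegree ≤ 1 := by
    intro p ℓ hℓ
    have key : ∀ j, ℓ ∈ V j → ℓ.totalDegree ≤ 1 := by
      intro j hj
      rw [hV] at hj
      obtain ⟨q, -, rfl⟩ := Multiset.mem_map.1 hj
      refine (totalDegree_sub _ _).trans (max_le ?_ ?_) <;> exact (totalDegree_X _).le
    rcases Multiset.mem_add.1 hℓ with h | h
    · exact key p.1 h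
    · exact key p.2 h
  have h2n : 2 * (n * n) ≤ n ^ 3 + 3 := by
    rcases Nat.lt_or_ge n 3 with h | h
    · interval_cases n <;> norm_num
    · calc 2 * (n * n) ≤ n * (n * n) := Nat.mul_le_mul_right _ (by omega)
        _ = n ^ 3 := by ring
        _ ≤ n ^ 3 + 3 := Nat.le_add_right _ _
  have hcard : ∀ p, Multiset.card (L p) ≤ n ^ 3 + 3 := by
    intro p
    rw [hL]
    simp only [Multiset.card_add]
    calc Multiset.card (V p.1) + Multiset.card (V p.2) ≤ n * n + n * n := Nat.add_le_add (hVcard _) (hVcard _)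
      _ = 2 * (n * n) := by ring
      _ ≤ n ^ 3 + 3 := h2n
  have main := ExplicitForm.pdClass_one_of_explicit (c := 3) hT a L hdeg hcard
  -- the explicit datum sums to `P_n`
  have hsum : (∑ p : Fin n × Fin n, C (a p) * (L p).prod) =
      ∑ T ∈ (univ : Finset (Fin n)).powersetCard 2,
        ∏ j ∈ T, ∏ i : Fin n, ∏ i' ∈ Ioi i, (X (i, j) - X (i', j) : MvPolynomial (Fin n × Fin n) ℂ) := by
    have hterm : ∀ p : Fin n × Fin n, C (a p) * (L p).prod =
        if p.1 < p.2 then (V p.1).prod * (V p.2).prod else 0 := by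
      intro p
      rw [hL]
      simp only [Multiset.prod_add, ha]
      split_ifs <;> simp
    simp only [hterm]
    rw [← sum_filter, sum_finset_product' r univ (fun i => Ioi i) hmem
      (f := fun j j' => (V j).prod * (V j').prod), sum_powersetCard_two]
    refine sum_congr rfl fun j _ => sum_congr rfl fun j' hj' => ?_
    rw [prod_pair (ne_of_lt (mem_Ioi.1 hj')), hVprod, hVprod]
  rw [← hsum]
  exact main

/-- **A CERTIFIED INSTANCE OF THE RUNG `A_∞`.**  The family `P_n = e₂(D_1, …, D_n)` of the column Vandermondes is
matrix-symmetric, lies in `PDClass (fun _ => 1) n c₁` for one constant `c₁` (the hypotheses of `stub_sigmaPiSigmaValue`),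
and is quasi-polynomially orbit-restorable with one constant (its conclusion) — by the term-block criterion, outside the
landed groupable kinds. [folklore; cite: DawarWilsenach2025, §3.3] -/
theorem sigmaPiSigmaValue_holds_e2_columnVandermondes :
    IsMatrixSymmetric (fun n => ∑ T ∈ (univ : Finset (Fin n)).powersetCard 2,
      ∏ j ∈ T, ∏ i : Fin n, ∏ i' ∈ Ioi i, (X (i, j) - X (i', j) : MvPolynomial (Fin n × Fin n) ℂ)) ∧
    (∃ c : ℕ, ∀ n : ℕ, PDClass (fun _ => 1) n c
      (∑ T ∈ (univ : Finset (Fin n)).powersetCard 2,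
        ∏ j ∈ T, ∏ i : Fin n, ∏ i' ∈ Ioi i, (X (i, j) - X (i', j) : MvPolynomial (Fin n × Fin n) ℂ))) ∧
    ∃ c : ℕ, ∀ n : ℕ, QPOrbitRestorable c n
      (∑ T ∈ (univ : Finset (Fin n)).powersetCard 2,
        ∏ j ∈ T, ∏ i : Fin n, ∏ i' ∈ Ioi i, (X (i, j) - X (i', j) : MvPolynomial (Fin n × Fin n) ℂ)) :=
  ⟨isMatrixSymmetric_e2_columnVandermondes, ⟨_, pdClass_e2_columnVandermondes⟩,
    ⟨9, qpOrbitRestorable_e2_columnVandermondes⟩⟩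

end TermBlocks

end Summit.ValiantsHypothesis.ValiantsHypothesis.Theorems

end
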